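import Summits.KontsevichZagierPeriods.KontsevichZagierPeriods.Theses.LinRedNormalForm
import Literature.Barriers.KontsevichZagierPeriods.AlgebraicPrimitivesObstruction

/-!
# `DihedralNormalForm` (stmt-KontsevichZagierPeriods-3912): negative side — slices of semialgebraic primitives satisfy real polynomial relations

Landed copy of §8 of the crux work file `Cruxes/DihedralNormalForm/Disproof.lean` (cdisprove seat,
generation 3), companion of `LinearCombinationPrimitive.lean`: the SEMIALGEBRAIC INPUT of the
elimination step in the rule-(2) load-bearing analysis of the crux `DihedralNormalForm` (work file
§5).  The primitives `Fⱼ` of Newton–Leibniz moves are `ℚ`-semialgebraic functions of two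
variables on their bands; the elimination runs along two lines `x₀ = r₁, r₂` with REAL (a.e.-generic)
parameters, so one needs polynomial relations for the slices `x₁ ↦ Fⱼ(r, x₁)` with real
coefficients:

* `isSemialgebraic_real_of_rat` — base change: `ℚ`-semialgebraic sets are `ℝ`-semialgebraic;
* `isSemialgebraic_slice_cons`, `isSemialgebraicFunOn_slice` — the slice of an `ℝ`-semialgebraic
  set (function) at a real first coordinate is `ℝ`-semialgebraic (a polynomial preimage,
  `IsSemialgebraic.preimage_aeval`; no Tarski–Seidenberg);
* `exists_ne_zero_isOpen_real`, `exists_ne_zero_evalEval_eq_zero_real` — steps (A)–(B) of the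
  barrier file `AlgebraicPrimitivesObstruction` with real coefficients and over an arbitrary base
  set: an `ℝ`-semialgebraic function of one variable satisfies a non-trivial real polynomial
  relation (off the zero set of a non-zero polynomial a semialgebraic set is open and closed; a
  graph has empty interior);
* `exists_ne_zero_evalEval_slice` — hence every slice `x₁ ↦ F(r,x₁)` of a `ℚ`-semialgebraic `F`
  on `B ⊆ ℝ²` satisfies `P(x₁, F(r,x₁)) = 0` on its fibre with `P ≠ 0 ∈ ℝ[X][Y]`, for EVERY real `r`.

[Bochnak–Coste–Roy 1998, §2.2 (semialgebraic functions); Ayoub 2015, Rem. 1.2] -/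

noncomputable section

open Set Polynomial
open scoped Polynomial.Bivariate
open Literature.ModelTheory.ExponentialFields Literature.NumberTheory.Transcendental

namespace Summit.KontsevichZagierPeriods.DihedralNormalForm.Negative

/-! ### (a) base change `ℚ → ℝ` -/

/-- A `ℚ`-semialgebraic set is `ℝ`-semialgebraic. [folklore] -/
theorem isSemialgebraic_real_of_rat {ι : Type*} {s : Set (ι → ℝ)} (hs : IsSemialgebraic ℚ s) :
    IsSemialgebraic ℝ s := by
  unfold IsSemialgebraic semialgebraicSets at hs
  induction hs using BooleanSubalgebra.closure_bot_sup_induction with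
  | mem t ht =>
    rcases ht with ⟨p, rfl⟩ | ⟨p, rfl⟩
    · convert isSemialgebraic_setOf_eval_eq_zero (k := ℝ) (R := ℝ)
        (MvPolynomial.map (algebraMap ℚ ℝ) p) using 1
      ext x
      simp [MvPolynomial.aeval_map_algebraMap]
    · convert isSemialgebraic_setOf_eval_pos (k := ℝ) (R := ℝ)
        (MvPolynomial.map (algebraMap ℚ ℝ) p) using 1
      ext x
      simp [MvPolynomial.aeval_map_algebraMap]
  | bot => exact isSemialgebraic_empty
  | sup t _ u _ iht ihu => exact iht.union ihu
  | compl t _ iht => exact iht.compl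

/-! ### (b) slicing at a real first coordinate -/

/-- The slice `{x | (r, x) ∈ S}` of an `ℝ`-semialgebraic set at a real first coordinate is
`ℝ`-semialgebraic (a polynomial preimage). [folklore] -/
theorem isSemialgebraic_slice_cons {n : ℕ} {S : Set (Fin (n + 1) → ℝ)} (hS : IsSemialgebraic ℝ S)
    (r : ℝ) : IsSemialgebraic ℝ {x : Fin n → ℝ | (Fin.cons r x : Fin (n + 1) → ℝ) ∈ S} := by
  convert hS.preimage_aeval (Fin.cons (MvPolynomial.C r) (fun i => MvPolynomial.X i)) using 1
  ext x
  simp only [mem_setOf_eq, mem_preimage]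
  refine iff_of_eq (congrArg (· ∈ S) ?_)
  ext j
  refine Fin.cases ?_ (fun i => ?_) j
  · simp
  · simp

/-- `init` of a `cons` is the `cons` of the `init`. [folklore] -/
theorem init_cons {n : ℕ} (r : ℝ) (w : Fin (n + 1) → ℝ) :
    Fin.init (Fin.cons r w : Fin (n + 2) → ℝ) = Fin.cons r (Fin.init w) := by
  ext j
  refine Fin.cases ?_ (fun i => ?_) j
  · simp [Fin.init]
  · simp only [Fin.init, Fin.cons_succ]
    have : (Fin.castSucc (Fin.succ i) : Fin (n + 2)) = Fin.succ (Fin.castSucc i) := rfl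
    rw [this, Fin.cons_succ]

/-- The last entry of a `cons`. [folklore] -/
theorem cons_apply_last {n : ℕ} (r : ℝ) (w : Fin (n + 1) → ℝ) :
    (Fin.cons r w : Fin (n + 2) → ℝ) (Fin.last (n + 1)) = w (Fin.last n) := by
  rw [← Fin.succ_last, Fin.cons_succ]

/-- Slicing a semialgebraic function of two variables at a real first coordinate gives a
semialgebraic function of one variable (over `ℝ`). [folklore] -/
theorem isSemialgebraicFunOn_slice {B : Set (Fin 2 → ℝ)} {F : (Fin 2 → ℝ) → ℝ}
    (hF : IsSemialgebraicFunOn ℚ B F) (r : ℝ) :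
    IsSemialgebraicFunOn ℝ {x : Fin 1 → ℝ | (Fin.cons r x : Fin 2 → ℝ) ∈ B}
      (fun x => F (Fin.cons r x)) := by
  unfold IsSemialgebraicFunOn at hF ⊢
  have h := isSemialgebraic_slice_cons (isSemialgebraic_real_of_rat hF) r
  convert h using 1
  ext w
  simp only [mem_setOf_eq]
  constructor
  · rintro ⟨x, hx, rfl⟩
    exact ⟨Fin.cons r x, hx, Fin.cons_snoc_eq_snoc_cons r x (F (Fin.cons r x))⟩
  · rintro ⟨z, hz, hzw⟩
    have hzi : z = Fin.cons r (Fin.init w) := by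
      have := congrArg Fin.init hzw
      rw [Fin.init_snoc, init_cons] at this
      exact this.symm
    have hFz : F z = w (Fin.last 1) := by
      have := congrFun hzw (Fin.last 2)
      rw [cons_apply_last, Fin.snoc_last] at this
      exact this.symm
    refine ⟨Fin.init w, by rw [← hzi]; exact hz, ?_⟩
    rw [← hzi, hFz]
    exact (Fin.snoc_init_self w).symm

/-! ### (c) steps (A)–(B) of the barrier over `ℝ` -/

/-- Over `ℝ`, `aeval` is `eval`. [folklore] -/
theorem aeval_eq_eval_real {ι : Type*} (z : ι → ℝ) (p : MvPolynomial ι ℝ) :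
    MvPolynomial.aeval z p = MvPolynomial.eval z p := rfl

/-- **Step (A) over `ℝ`.** Every `ℝ`-semialgebraic subset of `ℝ²` is, off the zero set of some
non-zero real polynomial, both open and closed (induction over the Boolean algebra; copy of the
barrier's `NoSemialgPrim.exists_ne_zero_isOpen` with real coefficients). [folklore] -/
theorem exists_ne_zero_isOpen_real {S : Set (Fin 2 → ℝ)} (hS : IsSemialgebraic ℝ S) :
    ∃ q : MvPolynomial (Fin 2) ℝ, q ≠ 0 ∧ IsOpen (S ∩ {z | MvPolynomial.eval z q ≠ 0}) ∧
      IsOpen (Sᶜ ∩ {z | MvPolynomial.eval z q ≠ 0}) := by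
  unfold IsSemialgebraic semialgebraicSets at hS
  induction hS using BooleanSubalgebra.closure_bot_sup_induction with
  | mem S hS =>
    rcases hS with ⟨p, rfl⟩ | ⟨p, rfl⟩
    · by_cases hp : p = 0
      · subst hp
        refine ⟨1, one_ne_zero, ?_, ?_⟩
        · convert isOpen_univ
          ext z
          simp [aeval_eq_eval_real]
        · convert isOpen_empty
          ext z
          simp [aeval_eq_eval_real]
      · refine ⟨p, hp, ?_, ?_⟩
        · convert isOpen_empty
          ext z
          simp only [mem_inter_iff, mem_setOf_eq, aeval_eq_eval_real, mem_empty_iff_false,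
            iff_false, not_and, not_not]
          exact fun h => h
        · convert Literature.Barriers.KontsevichZagierPeriods.KZ.NoSemialgPrim.isOpen_eval_ne_zero p
            using 1
          ext z
          simp only [mem_inter_iff, mem_compl_iff, mem_setOf_eq, aeval_eq_eval_real]
          tauto
    · by_cases hp : p = 0
      · subst hp
        refine ⟨1, one_ne_zero, ?_, ?_⟩
        · convert isOpen_empty
          ext z
          simp [aeval_eq_eval_real]
        · convert isOpen_univ
          ext z
          simp [aeval_eq_eval_real]
      · refine ⟨p, hp, ?_, ?_⟩
        · have hopen : IsOpen {z : Fin 2 → ℝ | 0 < MvPolynomial.eval z p} :=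
            isOpen_lt continuous_const (MvPolynomial.continuous_eval _)
          convert hopen using 1
          ext z
          simp only [mem_inter_iff, mem_setOf_eq, aeval_eq_eval_real]
          exact ⟨fun h => h.1, fun h => ⟨h, h.ne'⟩⟩
        · have hopen : IsOpen {z : Fin 2 → ℝ | MvPolynomial.eval z p < 0} :=
            isOpen_lt (MvPolynomial.continuous_eval _) continuous_const
          convert hopen using 1
          ext z
          simp only [mem_inter_iff, mem_compl_iff, mem_setOf_eq, aeval_eq_eval_real, not_lt]
          exact ⟨fun h => lt_of_le_of_ne h.1 h.2, fun h => ⟨h.le, h.ne⟩⟩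
  | bot =>
    exact ⟨1, one_ne_zero, by simp, by simp⟩
  | sup S hS T hT ihS ihT =>
    obtain ⟨p, hp, hp1, hp2⟩ := ihS
    obtain ⟨q, hq, hq1, hq2⟩ := ihT
    refine ⟨p * q, mul_ne_zero hp hq, ?_, ?_⟩
    · have : ((S ⊔ T) ∩ {z : Fin 2 → ℝ | MvPolynomial.eval z (p * q) ≠ 0}) =
          (S ∩ {z | MvPolynomial.eval z p ≠ 0}) ∩ {z | MvPolynomial.eval z q ≠ 0} ∪
            (T ∩ {z | MvPolynomial.eval z q ≠ 0}) ∩ {z | MvPolynomial.eval z p ≠ 0} := by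
        ext z
        simp only [sup_eq_union, mem_inter_iff, mem_union, mem_setOf_eq, map_mul, mul_ne_zero_iff]
        tauto
      rw [this]
      exact (hp1.inter (Literature.Barriers.KontsevichZagierPeriods.KZ.NoSemialgPrim.isOpen_eval_ne_zero q)).union
        (hq1.inter (Literature.Barriers.KontsevichZagierPeriods.KZ.NoSemialgPrim.isOpen_eval_ne_zero p))
    · have : ((S ⊔ T)ᶜ ∩ {z : Fin 2 → ℝ | MvPolynomial.eval z (p * q) ≠ 0}) =
          (Sᶜ ∩ {z | MvPolynomial.eval z p ≠ 0}) ∩ (Tᶜ ∩ {z | MvPolynomial.eval z q ≠ 0}) := by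
        ext z
        simp only [sup_eq_union, compl_union, mem_inter_iff, mem_compl_iff, mem_setOf_eq, map_mul,
          mul_ne_zero_iff]
        tauto
      rw [this]
      exact hp2.inter hq2
  | compl S hS ih =>
    obtain ⟨p, hp, h1, h2⟩ := ih
    exact ⟨p, hp, h2, by simpa only [compl_compl] using h1⟩

/-- **Steps (A)+(B) over `ℝ`, packaged**: an `ℝ`-semialgebraic function of one variable on any
set `B` satisfies a non-trivial real polynomial relation on `B` (a graph has empty interior).
[folklore] -/
theorem exists_ne_zero_evalEval_eq_zero_real {B : Set (Fin 1 → ℝ)} {F : (Fin 1 → ℝ) → ℝ}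
    (hF : IsSemialgebraicFunOn ℝ B F) :
    ∃ P : ℝ[X][Y], P ≠ 0 ∧ ∀ x ∈ B, P.evalEval (x 0) (F x) = 0 := by
  set Γ : Set (Fin 2 → ℝ) :=
    {z | ∃ x ∈ B, z = Fin.snoc x (F x)} with hΓ
  have hΓ' : IsSemialgebraic ℝ Γ := hF
  obtain ⟨q, hq0, hopen, -⟩ := exists_ne_zero_isOpen_real hΓ'
  have hvan : ∀ z ∈ Γ, MvPolynomial.eval z q = 0 := by
    intro z hz
    by_contra hne
    obtain ⟨ε, hε, hball⟩ := Metric.isOpen_iff.mp hopen z ⟨hz, hne⟩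
    obtain ⟨x, hx, rfl⟩ := hz
    have hmem : (Fin.snoc x (F x + ε / 2) : Fin 2 → ℝ) ∈
        Metric.ball (Fin.snoc x (F x) : Fin 2 → ℝ) ε := by
      rw [Metric.mem_ball, dist_pi_lt_iff hε]
      intro i
      fin_cases i
      · simp [Fin.snoc, hε]
      · simp [Fin.snoc, abs_of_pos hε, half_lt_self hε]
    obtain ⟨⟨x', -, hxx'⟩, -⟩ := hball hmem
    have h0 : x = x' := by
      funext j
      fin_cases j
      simpa [Fin.snoc] using congrFun hxx' 0
    have h1 := congrFun hxx' 1
    simp only [Fin.snoc] at h1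
    simp [← h0] at h1
    exact absurd h1 hε.ne'
  refine ⟨(Polynomial.Bivariate.equivMvPolynomial ℝ).symm q, by simpa using hq0, ?_⟩
  intro x hx
  have hz : (Fin.snoc x (F x) : Fin 2 → ℝ) ∈ Γ := ⟨x, hx, rfl⟩
  have h := hvan _ hz
  rw [← Literature.Barriers.KontsevichZagierPeriods.KZ.NoSemialgPrim.evalEval_equivMvPolynomial_symm] at h
  have hx0 : (Fin.snoc x (F x) : Fin 2 → ℝ) 0 = x 0 := by simp [Fin.snoc]
  have hx1 : (Fin.snoc x (F x) : Fin 2 → ℝ) 1 = F x := by simp [Fin.snoc]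
  rw [hx0, hx1] at h
  exact h

/-! ### (d) slices of semialgebraic functions of two variables -/

/-- **Slices satisfy real polynomial relations.** For a `ℚ`-semialgebraic function `F` of two
variables on `B ⊆ ℝ²` and every real `r`, the slice `x₁ ↦ F(r, x₁)` satisfies a non-trivial REAL
polynomial relation `P(x₁, F(r,x₁)) = 0` on the fibre `{x₁ | (r,x₁) ∈ B}` — the input of the
elimination lemma `no_linearCombination_algebraic_primitive` (work file §7) for the primitives of
Newton–Leibniz moves in the rule-(2) analysis (§5). [folklore] -/
theorem exists_ne_zero_evalEval_slice {B : Set (Fin 2 → ℝ)} {F : (Fin 2 → ℝ) → ℝ}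
    (hF : IsSemialgebraicFunOn ℚ B F) (r : ℝ) :
    ∃ P : ℝ[X][Y], P ≠ 0 ∧ ∀ x₁ : ℝ, (Fin.cons r (fun _ => x₁) : Fin 2 → ℝ) ∈ B →
      P.evalEval x₁ (F (Fin.cons r fun _ => x₁)) = 0 := by
  obtain ⟨P, hP0, hP⟩ := exists_ne_zero_evalEval_eq_zero_real (isSemialgebraicFunOn_slice hF r)
  exact ⟨P, hP0, fun x₁ hx => hP (fun _ => x₁) hx⟩

end Summit.KontsevichZagierPeriods.DihedralNormalForm.Negative
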